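import Mathlib
import HarnessLib
import Summits.BirchSwinnertonDyer.BirchSwinnertonDyer.Theses.ManinLocalTwoThree
import Summits.BirchSwinnertonDyer.Statement
import Summits.BirchSwinnertonDyer.Rank1Residual.ManinConstantOne
import Literature.NumberTheory.EllipticCurves.ManinConstantSemistablePrimewise
import Literature.NumberTheory.EllipticCurves.ManinConstantQuadraticTwistAtTwoProofs
import Literature.NumberTheory.EllipticCurves.ManinConstantClassCertificateTwistGamma0Proofs
import Literature.NumberTheory.EllipticCurves.IsogenyIdProofs

/-!
# Lines/birth.lean — BC3 birth skeleton of crux `ManinPrimeToThreeAtNine` (route ManinLocalTwoThree, EDIT-2 typing (= EDIT-1 crux statements; modularity folded into the facts support);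
planner bsd-f2-manin-imc g7, 2026-08-27; composition re-cut to use the stubs BY NAME for `ledger skeleton check` by cell writer -imc g8, 2026-08-27)

Two named stubs = a genuine partition of the crux by the predicate «the isogeny class of `W` is a
quadratic twist (d ∈ {-3}) of a class with `3² ∤ N'`» (TWIST-COVERED vs TWIST-MINIMAL at `3`),
both in the crux's `(h : Fact) →` form (printed semistable facts + modularity as hypotheses):
* `stub_twistCoveredAtThree` — the twist-covered classes (the landed certificates
  `not_dvd_maninConstant_of_isTwistOfSemistableAtTwo_gamma0` / `…At_gamma0` close the `η = 1` part NOW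
  from exactly these four hypotheses; the `η = 2` part at `2` is open — cell card manin-eta-two-hecke-pairing);
* `stub_twistMinimalAtThree` — the twist-minimal additive classes: the hard core, no printed theorem
  (ČNS 2020 only bound `v_p(c) ≤ v_p(deg φ) (+1)`).
`ManinPrimeToThreeAtNine_of` is the kernel-checked composition (excluded middle on the predicate), concluding the
ROUTE DECL by name.
-/

set_option autoImplicit false
set_option linter.dupNamespace false

noncomputable section

open WeierstrassCurve Literature.NumberTheory.EllipticCurves
  Literature.NumberTheory.EllipticCurves.ModularForms
namespace Summit.BirchSwinnertonDyer.BirchSwinnertonDyer.Cruxes.ManinPrimeToThreeAtNine.Birth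

/-- STUB 1 (TWIST-COVERED AT 3). -/
theorem stub_twistCoveredAtThree :
      Literature.NumberTheory.EllipticCurves.ModularForms.mazur_not_dvd_maninConstant_of_odd →
      Literature.NumberTheory.EllipticCurves.ModularForms.abbesUllmo_not_dvd_maninConstant_of_not_dvd_level →
      Literature.NumberTheory.EllipticCurves.ModularForms.cesnavicius_not_two_dvd_maninConstant_of_two_dvd_level →
      Literature.NumberTheory.EllipticCurves.ModularForms.exists_isNewformOf →
      ∀ (W : WeierstrassCurve ℚ) [W.IsElliptic] [W.IsGloballyMinimal] {N : ℕ} [NeZero N]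
        (D : ModularParametrizationData W N),
        (∀ z ∈ D.L.lattice, ∃ w ∈ periodLattice D.f, z = D.c * w) → 3 ^ 2 ∣ N →
        (∃ (W' : WeierstrassCurve ℚ) (d : ℤ), W'.IsElliptic ∧ W'.IsGloballyMinimal ∧
          (d = -3) ∧ IsIsogenous W (W'.quadraticTwist (d : ℚ)) ∧
          ¬ 3 ^ 2 ∣ W'.conductorNorm ℤ) →
        ¬ (3 : ℤ) ∣ D.maninConstant := by
  sorry

/-- STUB 2 (TWIST-MINIMAL AT 3). -/
theorem stub_twistMinimalAtThree :
      Literature.NumberTheory.EllipticCurves.ModularForms.mazur_not_dvd_maninConstant_of_odd →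
      Literature.NumberTheory.EllipticCurves.ModularForms.abbesUllmo_not_dvd_maninConstant_of_not_dvd_level →
      Literature.NumberTheory.EllipticCurves.ModularForms.cesnavicius_not_two_dvd_maninConstant_of_two_dvd_level →
      Literature.NumberTheory.EllipticCurves.ModularForms.exists_isNewformOf →
      ∀ (W : WeierstrassCurve ℚ) [W.IsElliptic] [W.IsGloballyMinimal] {N : ℕ} [NeZero N]
        (D : ModularParametrizationData W N),
        (∀ z ∈ D.L.lattice, ∃ w ∈ periodLattice D.f, z = D.c * w) → 3 ^ 2 ∣ N →
        ¬ (∃ (W' : WeierstrassCurve ℚ) (d : ℤ), W'.IsElliptic ∧ W'.IsGloballyMinimal ∧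
          (d = -3) ∧ IsIsogenous W (W'.quadraticTwist (d : ℚ)) ∧
          ¬ 3 ^ 2 ∣ W'.conductorNorm ℤ) →
        ¬ (3 : ℤ) ∣ D.maninConstant := by
  sorry

/-- COMPOSITION (no sorry): the two stubs give the crux, BY NAME. -/
theorem ManinPrimeToThreeAtNine_of :
    Summit.BirchSwinnertonDyer.BirchSwinnertonDyer.Theses.ManinLocalTwoThree.ManinPrimeToThreeAtNine := by
  intro hM hAU hC hnf W _ _ N _ D hopt hp
  by_cases hex : (∃ (W' : WeierstrassCurve ℚ) (d : ℤ), W'.IsElliptic ∧ W'.IsGloballyMinimal ∧  (d = -3) ∧ IsIsogenous W (W'.quadraticTwist (d : ℚ)) ∧  ¬ 3 ^ 2 ∣ W'.conductorNorm ℤ)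
  · exact stub_twistCoveredAtThree hM hAU hC hnf W D hopt hp hex
  · exact stub_twistMinimalAtThree hM hAU hC hnf W D hopt hp hex

end Summit.BirchSwinnertonDyer.BirchSwinnertonDyer.Cruxes.ManinPrimeToThreeAtNine.Birth

end
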